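import Literature.AlgebraicGeometry.PlaneCurves.HesseCanonicalForm
import Literature.AlgebraicGeometry.PlaneCurves.HessePencilHessianGroup
import HarnessLib

/-!
# The tetrahedral group of the Hesse pencil: which members are projectively equivalent
# (Bonifant–Milnor, Lemma 3.11 and Theorem 3.12; Artebani–Dolgachev §4)

Topic `Literature/AlgebraicGeometry/PlaneCurves`, namespace `Literature.AlgebraicGeometry.PlaneCurves`.
Lane `lit-hodgefound`, seat `lit-hodgefound-p37`, row g19-#1; a one-file sequel of the seat's
`HesseCanonicalForm` (g17-#7: two smooth members `H_μ`, `H_ν` are projectively equivalent over a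
separably closed field iff `μ³(μ³ + 8)³/(μ³ − 1)³ = ν³(ν³ + 8)³/(ν³ − 1)³`) and
`HessePencilHessianGroup` (g18-#5: `g₃` acts on parameters by the involution `μ ↦ (μ + 2)/(μ − 1)`,
`g₄` by `μ ↦ ω²μ`).  It answers the question those two files leave open — WHICH parameters give
projectively equivalent members — by the printed answer: the orbits of the twelve-element
tetrahedral group.  Everything here is PROVED; no definition, no named fact.

Source followed — A. Bonifant, J. Milnor, *On real and complex cubic curves*, L'Enseignement
Math. 63 (2017) 21–61, §3 [journal scan held as `paper:galaxy-pdf-4605502542324595860`, p0103 L14 –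
p0104 L6, p0116 L7 – p0117 L18, p0120 L1–L10], VERBATIM (their Hesse curve `𝒞(k)` is
`x³ + y³ + z³ = 3kxyz`, i.e. EXACTLY the lane's `H_k = X³ + Y³ + Z³ − 3kXYZ`, and their `J` is
`j/1728`):

> (14) `J(𝒞(k)) = (k(k³ + 8)/(4(k³ − 1)))³` […] One noteworthy property is the following. Let
> `η : Ĉ → Ĉ` be the Möbius involution (15) `η(k) = (k + 2)/(k − 1)`, with `η ∘ η(k) = k`.
> **Lemma 3.11.** This function `J(k) = J(𝒞(k))` satisfies the identity `J(η(k)) = J(k)` for all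
> `k ∈ Ĉ = ℂ ∪ {∞}`. […] *First proof.* The equation `J(η(k)) = J(k)` is an identity between two
> rational functions of degree twelve, which can be verified by direct computation. However, this
> argument gives no clue as to how to construct an actual projective equivalence between `𝒞(k)` and
> `𝒞(η(k))`. That can be remedied as follows. *Second proof.* Let `X = x + y + z`,
> `Y = x + γy + γ̄z`, `Z = x + γ̄y + γz` where `γ = e^{2πi/3}`. […]
> **Theorem 3.12.** Let `Γ` denote the group of Möbius transformations generated by the involution
> `η` and the rotation `ρ(k) = γk`. Then `Γ` is equal to the twelve element **tetrahedral group**,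
> consisting of all Möbius transformations from the Riemann sphere to itself which map the four
> point set `{1, γ, γ̄, ∞}` to itself. Furthermore:
> (1) Two Hesse curves `𝒞(k)` and `𝒞(k′)` are projectively equivalent if and only if `k′ = μ(k)`
> for some `μ ∈ Γ`.
> (2) The function `k ↦ J(k)` can be computed as `J(k) = (1/64) ∏_{μ ∈ Γ} μ(k)`.
> *Proof.* (Compare [AD].) Clearly `η : 1 ↔ ∞` under the involution `η`, and it is not hard to
> check that `η : γ ↔ γ̄`. […] It is not hard to check that the orbit of `1 + √3` consists of the
> following six points, each counted twice since `1 + √3` is a fixed point of `η`: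
> `1 + √3, (1 + √3)γ, (1 + √3)γ̄, 1 − √3, (1 − √3)γ, (1 − √3)γ̄`. […] Comparing this with
> `J(1 + √3) = 1`, the conclusion follows. [footnote 10: In particular, note that
> `ρ⁻¹ ∘ η ∘ ρ(1 + √3) = 1 − √3`.]

and M. Artebani, I. Dolgachev, *The Hesse pencil of plane cubic curves*, Enseign. Math. 55
(2009), §4 [held `paper:arxiv-math_0611590` p0008 L22–L30]: "its subgroup `A₄` acts as a
tetrahedral group with orbits of cardinalities `12, 6, 4, 4`. This suggests that the image of (α)
is indeed isomorphic to `A₄`. In order to see it, it is enough to exhibit transformations from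
`G₂₁₆` which are mapped to generators of `A₄` of orders `2` and `3`" (`g₃ ↦ η`, `g₄ ↦ ρ²`).

## Dictionary

* `γ` (`ε` in [AD]) is an `ω ∈ K` with `ω² + ω + 1 = 0`; `𝐇[k] = X³ + Y³ + Z³ − 3kXYZ`;
  `𝐣[k] := k³(k³ + 8)³/(k³ − 1)³ = 64·J(k) = j(W_k)/27` (`HessePencilWeierstrassForm.hesse_weierstrass_j`)
  — a local notation for the printed rational function, no definition.
* THE TWELVE ELEMENTS OF `Γ`, written out (this is how "`k′ = μ(k)` for some `μ ∈ Γ`" is stated,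
  there being no definition): `Γ = ⟨η, ρ⟩ ≅ A₄ = V₄ ⋊ C₃` consists of the three rotations
  `k ↦ ω^a k` and the nine maps `k ↦ ω^a (k + 2ω^b)/(k − ω^b)` (`a, b ∈ {0, 1, 2}`); indeed
  `(k + 2ω^b)/(k − ω^b) = η(ω^{2b} k)` (`moebius_eta_conj`), so these are the words `ρ^a η ρ^{2b}`,
  and the list is closed under `η` and `ρ` because `η² = 1`, `ρ³ = 1`, `(ηρ)³ = 1`
  (`moebius_eta_rho_pow_three`) present `A₄`.  For a smooth member (`k³ ≠ 1`) all twelve values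
  are finite, and "`k′` is in the `Γ`-orbit of `k`" reads
  `(∃ a, k′ = ω^a k) ∨ (∃ a b, (k − ω^b) k′ = ω^a (k + 2ω^b))`.
* "projectively equivalent": `H_k ∘ M = c · H_{k′}` (`bind₁ M.toMvPolynomial 𝐇[k] = c • 𝐇[k′]`)
  with `det M ≠ 0`, `c ≠ 0`, as everywhere in the lane.

## What is here (`K` a field, `ω² + ω + 1 = 0`)

* §1 **Lemma 3.11 and `ρ`-invariance**: `hesseJ_omega_pow_mul` (`𝐣[ω^a k] = 𝐣[k]`), `hesseJ_eta`
  (`𝐣[η(k)] = 𝐣[k]` for `k³ ≠ 1`, `3 ≠ 0` — "an identity between two rational functions of degree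
  twelve"), `moebius_eta_conj`, `hesseJ_tetrahedral` (`𝐣` is constant on each of the twelve maps).
* §2 **Theorem 3.12 (1), algebraic form, ANY field**: `hesseJ_eq_iff` — for `k³, k′³ ≠ 1`,
  `𝐣[k] = 𝐣[k′]` iff `k′` is one of the twelve values.  Proof: the degree-`21` identity
  `k³(k³+8)³(k′³−1)³ − k′³(k′³+8)³(k³−1)³ = −(k′³ − k³)·(α³ + β³ + γ³ − 3αβγ)` with
  `α = (k³−1)k′³ − (k³+8)`, `β = −3k²(k′³+2)`, `γ = 3k(k′³−4)`, and
  `α³ + β³ + γ³ − 3αβγ = ∏_b (α + ω^bβ + ω^{2b}γ)`, `α + ω^bβ + ω^{2b}γ = ((k − ω^b)k′)³ − (k + 2ω^b)³`.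
* §3 **Theorem 3.12 (1)**: `hesse_exists_bind₁_of_tetrahedral` — Milnor's "actual projective
  equivalence" for EVERY element of `Γ` over any field with `3 ≠ 0` (the matrices
  `diag(1, ω^b, ω^b) · g₃ · diag(1, ω^{2a}, ω^{2a})`), and
  **`hesse_exists_bind₁_eq_smul_iff_tetrahedral`** — over a separably closed field with `3 ≠ 0`,
  `H_k` and `H_{k′}` (`k³, k′³ ≠ 1`) are projectively equivalent iff `k′ ∈ Γ·k`.
* §4 **Theorem 3.12 (2)**: `hesse_tetrahedral_prod` — `∏_{μ ∈ Γ} μ(k) = 𝐣[k]` (`= 64 J(k)`), and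
  `hesse_tetrahedral_prod_eq_j` — `27 · ∏_{μ ∈ Γ} μ(k) = j(W_k)` (Mathlib's `j` of the lane's
  Weierstrass model of `H_k`).
* §5 **The group**: `moebius_eta_cusps` ("`η : 1 ↔ ∞`, `η : γ ↔ γ̄`", in homogeneous coordinates),
  `moebius_eta_rho_pow_three` (`(ηρ)³` is the scalar `−3(2ω + 1)`, `(2ω + 1)² = −3`: the
  presentation `⟨η, ρ | η², ρ³, (ηρ)³⟩` of the tetrahedral group `A₄`), and Milnor's example
  `hesseJ_one_add_sqrt_three` (`J(1 + √3) = 1`, i.e. `𝐣 = 64`), `moebius_eta_one_add_sqrt_three`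
  (`η` fixes `1 + √3`, `ρ⁻¹ηρ(1 + √3) = 1 − √3`).

NOT here: that these twelve maps are ALL the Möbius transformations preserving `{1, γ, γ̄, ∞}`
(the identification `Γ = A₄` as a permutation group), the orbit CARDINALITIES `12, 6, 4, 4` of
[AD] (pairwise distinctness of the twelve values away from `J = 0, 1`), and the real picture
(Figure 3, Theorem 6.3).

## References
* [BonifantMilnor2018] A. Bonifant, J. Milnor, *On real and complex cubic curves*, Enseign. Math.
  63 (2017), no. 1-2, 21–61, §3: eq. (14), (15), Lemma 3.11, Theorem 3.12 (doi 10.4171/lem/63-1/2-2).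
* [ArtebaniDolgachev2009] M. Artebani, I. Dolgachev, *The Hesse pencil of plane cubic curves*,
  Enseign. Math. (2) 55 (2009) 235–273, §4 (the image `A₄` of `α : G₂₁₆ → Aut(ℙ¹)`, orbits
  `12, 6, 4, 4`).
-/

set_option autoImplicit false

open MvPolynomial Matrix

namespace Literature.AlgebraicGeometry.PlaneCurves

universe u

/-- The Hesse cubic `H_μ = X³ + Y³ + Z³ − 3μXYZ` (local notation as in `HessePencilWeierstrassForm`,
no definition). -/
local notation3 "𝐇[" μ "]" =>
  (X 0 ^ 3 + X 1 ^ 3 + X 2 ^ 3 - C (3 * μ) * (X 0 * X 1 * X 2) : MvPolynomial (Fin 3) _)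

/-- Bonifant–Milnor's `64·J(𝒞(k)) = k³(k³ + 8)³/(k³ − 1)³` (eq. (14); `= j(W_k)/27`), the rational
function of `HesseCanonicalForm.hesse_exists_bind₁_eq_smul_iff` (local notation, no definition). -/
local notation3 "𝐣[" k "]" => (k ^ 3 * (k ^ 3 + 8) ^ 3 / (k ^ 3 - 1) ^ 3)

/-- `g₃ = [[1, 1, 1], [1, ε, ε²], [1, ε², ε]]` (local notation as in `HessePencilHessianGroup`). -/
local notation3 "𝐠₃[" ω "]" =>
  (Matrix.of ![![(1 : _), 1, 1], ![1, ω, ω ^ 2], ![1, ω ^ 2, ω]] : Matrix (Fin 3) (Fin 3) _)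

/-- `diag(1, ζ, ζ)` (`= g₄` for `ζ = ε`; local notation, no definition). -/
local notation3 "𝐝[" ζ "]" =>
  (Matrix.of ![![(1 : _), 0, 0], ![0, ζ, 0], ![0, 0, ζ]] : Matrix (Fin 3) (Fin 3) _)

section TetrahedralOrbits

variable {K : Type u} [Field K]

/-! ## §0 Cube roots of unity (plumbing) -/

/-- `ω² + ω + 1 = 0 ⇒ ω³ = 1`. [folklore] -/
private theorem omega_pow_three' {ω : K} (hω : ω ^ 2 + ω + 1 = 0) : ω ^ 3 = 1 := by
  linear_combination (ω - 1) * hω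

/-- `(ω^a)³ = 1`. [folklore] -/
private theorem omega_pow_pow_three {ω : K} (hω : ω ^ 2 + ω + 1 = 0) (a : ℕ) : (ω ^ a) ^ 3 = 1 := by
  rw [← pow_mul, mul_comm, pow_mul, omega_pow_three' hω, one_pow]

/-- `ω^a ≠ 0`. [folklore] -/
private theorem omega_pow_ne_zero {ω : K} (hω : ω ^ 2 + ω + 1 = 0) (a : ℕ) : ω ^ a ≠ 0 := by
  intro h
  have := omega_pow_pow_three hω a
  rw [h, zero_pow three_ne_zero] at this
  exact zero_ne_one this

/-- `x³ − y³ = (x − y)(x − ωy)(x − ω²y)`. [folklore] -/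
private theorem pow_three_sub_pow_three {ω : K} (hω : ω ^ 2 + ω + 1 = 0) (x y : K) :
    x ^ 3 - y ^ 3 = (x - y) * (x - ω * y) * (x - ω ^ 2 * y) := by
  linear_combination (x ^ 2 * y - ω * x * y ^ 2 + (ω - 1) * y ^ 3) * hω

/-- `x³ = y³ ↔ x = ω^a y` for some `a ∈ {0, 1, 2}`. [folklore] -/
private theorem pow_three_eq_pow_three_iff {ω : K} (hω : ω ^ 2 + ω + 1 = 0) (x y : K) :
    x ^ 3 = y ^ 3 ↔ ∃ a : Fin 3, x = ω ^ (a : ℕ) * y := by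
  rw [← sub_eq_zero, pow_three_sub_pow_three hω, mul_eq_zero, mul_eq_zero, sub_eq_zero, sub_eq_zero,
    sub_eq_zero]
  constructor
  · rintro ((h | h) | h)
    · exact ⟨0, by simpa using h⟩
    · exact ⟨1, by simpa using h⟩
    · exact ⟨2, by simpa using h⟩
  · rintro ⟨a, ha⟩
    fin_cases a
    · left; left; simpa using ha
    · left; right; simpa using ha
    · right; simpa using ha

/-- A smooth parameter is not a cube root of unity: `k³ ≠ 1 ⇒ k ≠ ω^b`. [folklore] -/
private theorem ne_omega_pow_of_pow_three_ne_one {ω : K} (hω : ω ^ 2 + ω + 1 = 0) {k : K}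
    (hk : k ^ 3 ≠ 1) (b : ℕ) : k - ω ^ b ≠ 0 := by
  intro h
  apply hk
  rw [sub_eq_zero.1 h, omega_pow_pow_three hω]

/-- `k³ ≠ 1 ⇒ ω^c k ≠ 1`. [folklore] -/
private theorem omega_pow_mul_ne_one {ω : K} (hω : ω ^ 2 + ω + 1 = 0) {k : K} (hk : k ^ 3 ≠ 1)
    (c : ℕ) : ω ^ c * k ≠ 1 := by
  intro h
  apply hk
  have := congrArg (· ^ 3) h
  simpa [mul_pow, omega_pow_pow_three hω] using this

/-! ## §1 Lemma 3.11: `J(η(k)) = J(k)`, and `J(γk) = J(k)` -/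

/-- **`ρ`-invariance**: `𝐣[ω^a k] = 𝐣[k]` ("we can always multiply the parameter `k` by a cube
root of unity without changing the projective equivalence class", `(ω^a k)³ = k³`).
[cite: BonifantMilnor2018, §3, before eq. (14)] -/
theorem hesseJ_omega_pow_mul {ω : K} (hω : ω ^ 2 + ω + 1 = 0) (a : ℕ) (k : K) :
    𝐣[ω ^ a * k] = 𝐣[k] := by
  rw [mul_pow, omega_pow_pow_three hω, one_mul]

/-- **Bonifant–Milnor, Lemma 3.11: `J(η(k)) = J(k)`**, `η(k) = (k + 2)/(k − 1)` — "an identity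
between two rational functions of degree twelve, which can be verified by direct computation";
here for every `k` with `k³ ≠ 1` over any field with `3 ≠ 0` (then `η(k)³ ≠ 1` as well, by
`HessePencilHessianGroup.moebius_g₃_pow_three_sub_one`). [cite: BonifantMilnor2018, §3, Lemma 3.11] -/
theorem hesseJ_eta (h3 : (3 : K) ≠ 0) {k : K} (hk : k ^ 3 ≠ 1) :
    𝐣[(k + 2) / (k - 1)] = 𝐣[k] := by
  have hk1 : k ≠ 1 := fun h => hk (by rw [h, one_pow])
  have hk1' : k - 1 ≠ 0 := sub_ne_zero.2 hk1
  have hq : k ^ 2 + k + 1 ≠ 0 := by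
    intro h
    apply hk
    linear_combination (k - 1) * h
  have h9 : (9 : K) ≠ 0 := by
    rw [show (9 : K) = 3 * 3 by norm_num]
    exact mul_ne_zero h3 h3
  have hk3 : k ^ 3 - 1 ≠ 0 := sub_ne_zero.2 hk
  have e1 : ((k + 2) / (k - 1)) ^ 3 * (((k + 2) / (k - 1)) ^ 3 + 8) ^ 3 =
      ((k + 2) / (k - 1) * (((k + 2) / (k - 1)) ^ 3 + 8)) ^ 3 := by ring
  rw [e1, moebius_g₃_equianharmonic hk1, moebius_g₃_pow_three_sub_one hk1, div_pow, div_pow,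
    div_div_div_eq, div_eq_div_iff _ (pow_ne_zero _ hk3)]
  · ring
  · exact mul_ne_zero (pow_ne_zero _ (pow_ne_zero _ hk1'))
      (pow_ne_zero _ (mul_ne_zero h9 hq))

/-- The nine non-rotations of `Γ` are conjugates of `η`: `(k + 2ω^b)/(k − ω^b) = η(ω^{2b}k)`
(`ρ^{2b} = ρ^{−b}`; both denominators are non-zero for `k³ ≠ 1`).
[cite: BonifantMilnor2018, §3, Theorem 3.12 (proof: `Γ` generated by `η` and `ρ`)] -/
theorem moebius_eta_conj {ω : K} (hω : ω ^ 2 + ω + 1 = 0) {k : K} (hk : k ^ 3 ≠ 1) (b : ℕ) :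
    (k + 2 * ω ^ b) / (k - ω ^ b) = (ω ^ (2 * b) * k + 2) / (ω ^ (2 * b) * k - 1) := by
  have hb := omega_pow_pow_three hω b
  have h1 := ne_omega_pow_of_pow_three_ne_one hω hk b
  have h2 : ω ^ (2 * b) * k - 1 ≠ 0 := sub_ne_zero.2 (omega_pow_mul_ne_one hω hk (2 * b))
  rw [div_eq_div_iff h1 h2]
  have e : ω ^ (2 * b) = (ω ^ b) ^ 2 := by rw [← pow_mul, mul_comm]
  rw [e]
  linear_combination 3 * k * hb

/-- **`J` is constant along `Γ`**: `𝐣[ω^a (k + 2ω^b)/(k − ω^b)] = 𝐣[k]` for all `a, b` and every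
`k³ ≠ 1` (`3 ≠ 0`) — Lemma 3.11 transported by `ρ`. [cite: BonifantMilnor2018, §3, Lemma 3.11 and
Theorem 3.12 (proof: "`J ∘ μ = J` for every `μ ∈ Γ`")] -/
theorem hesseJ_tetrahedral (h3 : (3 : K) ≠ 0) {ω : K} (hω : ω ^ 2 + ω + 1 = 0) {k : K}
    (hk : k ^ 3 ≠ 1) (a b : ℕ) :
    𝐣[ω ^ a * ((k + 2 * ω ^ b) / (k - ω ^ b))] = 𝐣[k] := by
  rw [hesseJ_omega_pow_mul hω, moebius_eta_conj hω hk b, hesseJ_eta h3, hesseJ_omega_pow_mul hω]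
  rw [mul_pow, omega_pow_pow_three hω, one_mul]
  exact hk

/-! ## §2 Theorem 3.12 (1) in algebraic form: the fibres of `J` are the `Γ`-orbits -/

/-- The cross-multiplied difference, factored (degree `21`; `ω`-free). [folklore] -/
private theorem hesseJ_cross_sub (k l : K) :
    k ^ 3 * (k ^ 3 + 8) ^ 3 * (l ^ 3 - 1) ^ 3 - l ^ 3 * (l ^ 3 + 8) ^ 3 * (k ^ 3 - 1) ^ 3 =
      -((l ^ 3 - k ^ 3) *
        (((k ^ 3 - 1) * l ^ 3 - (k ^ 3 + 8)) ^ 3 + (-3 * k ^ 2 * (l ^ 3 + 2)) ^ 3 +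
          (3 * k * (l ^ 3 - 4)) ^ 3 -
          3 * ((k ^ 3 - 1) * l ^ 3 - (k ^ 3 + 8)) * (-3 * k ^ 2 * (l ^ 3 + 2)) * (3 * k * (l ^ 3 - 4)))) := by
  ring

/-- `α³ + β³ + γ³ − 3αβγ = (α + β + γ)(α + ωβ + ω²γ)(α + ω²β + ωγ)`. [folklore] -/
private theorem cube_sum_factor {ω : K} (hω : ω ^ 2 + ω + 1 = 0) (α β γ : K) :
    α ^ 3 + β ^ 3 + γ ^ 3 - 3 * α * β * γ =
      (α + β + γ) * (α + ω * β + ω ^ 2 * γ) * (α + ω ^ 2 * β + ω * γ) := by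
  linear_combination (-(α ^ 2 * β) - α ^ 2 * γ - α * β ^ 2 * ω - α * β * γ * ω ^ 2 + α * β * γ * ω -
    3 * α * β * γ - α * γ ^ 2 * ω - β ^ 3 * ω + β ^ 3 - β ^ 2 * γ * ω ^ 2 - β * γ ^ 2 * ω ^ 2 -
    γ ^ 3 * ω + γ ^ 3) * hω

/-- The three linear combinations are differences of cubes:
`α + ω^bβ + ω^{2b}γ = ((k − ω^b)l)³ − (k + 2ω^b)³` (`b = 0, 1, 2`). [folklore] -/
private theorem hesseJ_factors {ω : K} (hω : ω ^ 2 + ω + 1 = 0) (k l : K) :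
    ((k ^ 3 - 1) * l ^ 3 - (k ^ 3 + 8)) + (-3 * k ^ 2 * (l ^ 3 + 2)) + (3 * k * (l ^ 3 - 4)) =
        ((k - 1) * l) ^ 3 - (k + 2) ^ 3 ∧
      ((k ^ 3 - 1) * l ^ 3 - (k ^ 3 + 8)) + ω * (-3 * k ^ 2 * (l ^ 3 + 2)) +
          ω ^ 2 * (3 * k * (l ^ 3 - 4)) = ((k - ω) * l) ^ 3 - (k + 2 * ω) ^ 3 ∧
      ((k ^ 3 - 1) * l ^ 3 - (k ^ 3 + 8)) + ω ^ 2 * (-3 * k ^ 2 * (l ^ 3 + 2)) +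
          ω * (3 * k * (l ^ 3 - 4)) = ((k - ω ^ 2) * l) ^ 3 - (k + 2 * ω ^ 2) ^ 3 := by
  refine ⟨by ring, ?_, ?_⟩
  · linear_combination (l ^ 3 * ω - l ^ 3 + 8 * ω - 8) * hω
  · linear_combination (-3 * k * l ^ 3 * ω ^ 2 + 3 * k * l ^ 3 * ω + 12 * k * ω ^ 2 - 12 * k * ω +
      l ^ 3 * ω ^ 4 - l ^ 3 * ω ^ 3 + l ^ 3 * ω - l ^ 3 + 8 * ω ^ 4 - 8 * ω ^ 3 + 8 * ω - 8) * hω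

/-- **Bonifant–Milnor, Theorem 3.12 (1), algebraic form over ANY field**: for `ω² + ω + 1 = 0` and
two smooth parameters `k³ ≠ 1`, `l³ ≠ 1`,
`k³(k³ + 8)³/(k³ − 1)³ = l³(l³ + 8)³/(l³ − 1)³` (i.e. `J(k) = J(l)`) **if and only if `l = μ(k)`
for one of the twelve `μ ∈ Γ`**: `l = ω^a k`, or `(k − ω^b) l = ω^a (k + 2ω^b)` for some
`a, b ∈ {0, 1, 2}`.  (Artebani–Dolgachev §4: the orbits of the tetrahedral group `A₄ = α(G₂₁₆)`.)
[cite: BonifantMilnor2018, §3, Theorem 3.12 (1)] [cite: ArtebaniDolgachev2009, §4 (the image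
`A₄` of `α`)] -/
theorem hesseJ_eq_iff {ω : K} (hω : ω ^ 2 + ω + 1 = 0) {k l : K} (hk : k ^ 3 ≠ 1)
    (hl : l ^ 3 ≠ 1) :
    𝐣[k] = 𝐣[l] ↔
      (∃ a : Fin 3, l = ω ^ (a : ℕ) * k) ∨
        ∃ a b : Fin 3, (k - ω ^ (b : ℕ)) * l = ω ^ (a : ℕ) * (k + 2 * ω ^ (b : ℕ)) := by
  have hk' : (k ^ 3 - 1) ^ 3 ≠ 0 := pow_ne_zero _ (sub_ne_zero.2 hk)
  have hl' : (l ^ 3 - 1) ^ 3 ≠ 0 := pow_ne_zero _ (sub_ne_zero.2 hl)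
  obtain ⟨f0, f1, f2⟩ := hesseJ_factors hω k l
  rw [div_eq_div_iff hk' hl', ← sub_eq_zero, hesseJ_cross_sub, neg_eq_zero, mul_eq_zero,
    cube_sum_factor hω, f0, f1, f2, mul_eq_zero, mul_eq_zero, sub_eq_zero, sub_eq_zero, sub_eq_zero,
    sub_eq_zero, pow_three_eq_pow_three_iff hω, pow_three_eq_pow_three_iff hω,
    pow_three_eq_pow_three_iff hω, pow_three_eq_pow_three_iff hω]
  -- `(∃ a, l = ω^a k) ∨ ((B₀ ∨ B₁) ∨ B₂) ↔ (∃ a, …) ∨ ∃ a b, …`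
  apply or_congr Iff.rfl
  constructor
  · rintro ((⟨a, h⟩ | ⟨a, h⟩) | ⟨a, h⟩)
    · exact ⟨a, 0, by simpa using h⟩
    · exact ⟨a, 1, by simpa using h⟩
    · exact ⟨a, 2, by simpa using h⟩
  · rintro ⟨a, b, h⟩
    fin_cases b
    · exact Or.inl (Or.inl ⟨a, by simpa using h⟩)
    · exact Or.inl (Or.inr ⟨a, by simpa using h⟩)
    · exact Or.inr ⟨a, by simpa using h⟩

/-! ## §3 Theorem 3.12 (1): projective equivalence of Hesse curves -/

/-- The linear forms of a `3 × 3` substitution, written out. [folklore] -/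
private theorem toMvPolynomial_fin_three_t (M : Matrix (Fin 3) (Fin 3) K) (i : Fin 3) :
    M.toMvPolynomial i = C (M i 0) * X 0 + C (M i 1) * X 1 + C (M i 2) * X 2 := by
  simp only [Matrix.toMvPolynomial, Fin.sum_univ_three, ← C_mul_X_eq_monomial]

/-- **`diag(1, ζ, ζ)` multiplies the parameter by `ζ²`** (`ζ³ = 1`): `H_k ∘ diag(1, ζ, ζ) = H_{ζ²k}`
— the rotation `ρ` realised by a projectivity ("simply by dividing one of the coordinates by this
root of unity"; `HessePencilHessianGroup.hesse_bind₁_g₄` is the case `ζ = ε`).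
[cite: BonifantMilnor2018, §3, before eq. (14)] -/
theorem hesse_bind₁_diag (k : K) {ζ : K} (hζ : ζ ^ 3 = 1) :
    bind₁ (𝐝[ζ] : Matrix (Fin 3) (Fin 3) K).toMvPolynomial 𝐇[k] = 𝐇[ζ ^ 2 * k] := by
  have hC : (C ζ : MvPolynomial (Fin 3) K) ^ 3 = 1 := by rw [← C_pow, hζ, C_1]
  simp only [map_sub, map_add, map_mul, map_pow, bind₁_X_right, bind₁_C_right,
    toMvPolynomial_fin_three_t, Matrix.of_apply, Matrix.cons_val_zero, Matrix.cons_val_one,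
    Matrix.cons_val_two, Matrix.head_cons, Matrix.tail_cons, map_one, map_zero, one_mul, zero_mul,
    add_zero, zero_add]
  linear_combination (X 1 ^ 3 + X 2 ^ 3 : MvPolynomial (Fin 3) K) * hC

/-- `det diag(1, ζ, ζ) = ζ²`. [folklore] -/
private theorem det_diag_one (ζ : K) : (𝐝[ζ] : Matrix (Fin 3) (Fin 3) K).det = ζ ^ 2 := by
  rw [Matrix.det_fin_three]
  simp
  ring

/-- **Bonifant–Milnor's "actual projective equivalence" (second proof of Lemma 3.11), for every
element of `Γ` and over any field with `3 ≠ 0`**: if `l` is in the `Γ`-orbit of a smooth parameter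
`k` (`k³ ≠ 1`), then `H_k ∘ M = c · H_l` for an invertible `M` and `c ≠ 0` — namely
`M = diag(1, ω^{2a}, ω^{2a})` for `l = ω^a k`, and `M = diag(1, ω^b, ω^b) · g₃ · diag(1, ω^{2a}, ω^{2a})`
(`g₃ = [[1,1,1],[1,ω,ω²],[1,ω²,ω]]`, the substitution `X = x + y + z, Y = x + γy + γ̄z,
Z = x + γ̄y + γz` of the source) for `(k − ω^b) l = ω^a (k + 2ω^b)`.
[cite: BonifantMilnor2018, §3, Lemma 3.11 (second proof) and Theorem 3.12 (1)] -/
theorem hesse_exists_bind₁_of_tetrahedral (h3 : (3 : K) ≠ 0) {ω : K} (hω : ω ^ 2 + ω + 1 = 0)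
    {k l : K} (hk : k ^ 3 ≠ 1)
    (h : (∃ a : Fin 3, l = ω ^ (a : ℕ) * k) ∨
      ∃ a b : Fin 3, (k - ω ^ (b : ℕ)) * l = ω ^ (a : ℕ) * (k + 2 * ω ^ (b : ℕ))) :
    ∃ (M : Matrix (Fin 3) (Fin 3) K) (c : K), M.det ≠ 0 ∧ c ≠ 0 ∧
      bind₁ M.toMvPolynomial 𝐇[k] = c • 𝐇[l] := by
  have e2 : ∀ n : ℕ, (ω ^ (2 * n)) ^ 2 = ω ^ n := fun n => by
    rw [← pow_mul, show 2 * n * 2 = 3 * n + n by ring, pow_add, pow_mul, omega_pow_three' hω,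
      one_pow, one_mul]
  rcases h with ⟨a, rfl⟩ | ⟨a, b, hab⟩
  · -- the rotation `ρ^a`
    refine ⟨𝐝[ω ^ (2 * (a : ℕ))], 1, ?_, one_ne_zero, ?_⟩
    · rw [det_diag_one]
      exact pow_ne_zero _ (omega_pow_ne_zero hω _)
    · rw [hesse_bind₁_diag k (omega_pow_pow_three hω _), one_smul, e2]
  · -- `ρ^a ∘ η ∘ ρ^{2b}`
    set b' : ℕ := (b : ℕ)
    set a' : ℕ := (a : ℕ)
    have hkb : ω ^ (2 * b') * k ≠ 1 := omega_pow_mul_ne_one hω hk _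
    have hl : l = ω ^ a' * ((ω ^ (2 * b') * k + 2) / (ω ^ (2 * b') * k - 1)) := by
      rw [← moebius_eta_conj hω hk b', mul_div_assoc',
        eq_div_iff (ne_omega_pow_of_pow_three_ne_one hω hk b')]
      linear_combination hab
    obtain ⟨hg₃, hc⟩ := hesse_bind₁_g₃_eq_smul h3 hkb hω
    refine ⟨𝐝[ω ^ b'] * 𝐠₃[ω] * 𝐝[ω ^ (2 * a')], 3 - 3 * (ω ^ (2 * b') * k), ?_, hc, ?_⟩
    · rw [Matrix.det_mul, Matrix.det_mul, det_diag_one, det_diag_one]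
      exact mul_ne_zero (mul_ne_zero (pow_ne_zero _ (omega_pow_ne_zero hω _)) (det_g₃_ne_zero h3 hω))
        (pow_ne_zero _ (omega_pow_ne_zero hω _))
    · rw [bind₁_toMvPolynomial_mul, bind₁_toMvPolynomial_mul,
        hesse_bind₁_diag k (omega_pow_pow_three hω _), show (ω ^ b') ^ 2 = ω ^ (2 * b') by
          rw [← pow_mul, mul_comm], hg₃, map_smul, hesse_bind₁_diag _ (omega_pow_pow_three hω _), e2,
        hl]

/-- **Bonifant–Milnor, Theorem 3.12 (1): "Two Hesse curves `𝒞(k)` and `𝒞(k′)` are projectively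
equivalent if and only if `k′ = μ(k)` for some `μ ∈ Γ`."**  Over a separably closed field with
`3 ≠ 0` (`ω² + ω + 1 = 0`), for smooth members `k³ ≠ 1`, `l³ ≠ 1`: there are an invertible `M` and
`c ≠ 0` with `H_k ∘ M = c · H_l` iff `l = ω^a k` or `(k − ω^b) l = ω^a(k + 2ω^b)` for some
`a, b ∈ {0, 1, 2}`.  Proof as printed: projective equivalence ⟺ `J(k) = J(l)`
(`HesseCanonicalForm.hesse_exists_bind₁_eq_smul_iff`) ⟺ same `Γ`-orbit (`hesseJ_eq_iff`).
[cite: BonifantMilnor2018, §3, Theorem 3.12 (1)] [cite: ArtebaniDolgachev2009, §4] -/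
theorem hesse_exists_bind₁_eq_smul_iff_tetrahedral [IsSepClosed K] (h3 : (3 : K) ≠ 0) {ω : K}
    (hω : ω ^ 2 + ω + 1 = 0) {k l : K} (hk : k ^ 3 ≠ 1) (hl : l ^ 3 ≠ 1) :
    (∃ (M : Matrix (Fin 3) (Fin 3) K) (c : K), M.det ≠ 0 ∧ c ≠ 0 ∧
        bind₁ M.toMvPolynomial 𝐇[k] = c • 𝐇[l]) ↔
      (∃ a : Fin 3, l = ω ^ (a : ℕ) * k) ∨
        ∃ a b : Fin 3, (k - ω ^ (b : ℕ)) * l = ω ^ (a : ℕ) * (k + 2 * ω ^ (b : ℕ)) := by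
  rw [hesse_exists_bind₁_eq_smul_iff h3 hk hl, hesseJ_eq_iff hω hk hl]

/-! ## §4 Theorem 3.12 (2): `J(k) = (1/64) ∏_{μ ∈ Γ} μ(k)` -/

/-- **Bonifant–Milnor, Theorem 3.12 (2): `J(k) = (1/64) ∏_{μ ∈ Γ} μ(k)`** — the product of the
twelve values `ω^a k` (`a < 3`) and `ω^a (k + 2ω^b)/(k − ω^b)` (`a, b < 3`) is
`k³(k³ + 8)³/(k³ − 1)³ = 64·J(k)`, for every `k³ ≠ 1` (`ω² + ω + 1 = 0`;
`∏_a ω^a k = k³`, `∏_b (k + 2ω^b) = k³ + 8`, `∏_b (k − ω^b) = k³ − 1`).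
[cite: BonifantMilnor2018, §3, Theorem 3.12 (2)] -/
theorem hesse_tetrahedral_prod {ω : K} (hω : ω ^ 2 + ω + 1 = 0) {k : K} (hk : k ^ 3 ≠ 1) :
    (∏ a : Fin 3, ω ^ (a : ℕ) * k) *
        ∏ a : Fin 3, ∏ b : Fin 3, ω ^ (a : ℕ) * ((k + 2 * ω ^ (b : ℕ)) / (k - ω ^ (b : ℕ))) = 𝐣[k] := by
  have hω3 := omega_pow_three' hω
  have h0 : k - 1 ≠ 0 := by simpa using ne_omega_pow_of_pow_three_ne_one hω hk 0
  have h1 : k - ω ≠ 0 := by simpa using ne_omega_pow_of_pow_three_ne_one hω hk 1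
  have h2 : k - ω ^ 2 ≠ 0 := ne_omega_pow_of_pow_three_ne_one hω hk 2
  have hN : (k + 2) * (k + 2 * ω) * (k + 2 * ω ^ 2) = k ^ 3 + 8 := by
    linear_combination (-1 : K) * pow_three_sub_pow_three hω k (-2)
  have hD : (k - 1) * (k - ω) * (k - ω ^ 2) = k ^ 3 - 1 := by
    linear_combination (-1 : K) * pow_three_sub_pow_three hω k 1
  calc (∏ a : Fin 3, ω ^ (a : ℕ) * k) *
        ∏ a : Fin 3, ∏ b : Fin 3, ω ^ (a : ℕ) * ((k + 2 * ω ^ (b : ℕ)) / (k - ω ^ (b : ℕ)))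
      = (ω ^ 3) ^ 4 * k ^ 3 *
          (((k + 2) * (k + 2 * ω) * (k + 2 * ω ^ 2)) / ((k - 1) * (k - ω) * (k - ω ^ 2))) ^ 3 := by
        simp only [Fin.prod_univ_three, Fin.val_zero, Fin.val_one, Fin.val_two, pow_zero, pow_one,
          one_mul, mul_one]
        field_simp
    _ = 𝐣[k] := by rw [hω3, hN, hD, one_pow, one_mul, div_pow, mul_div_assoc']

/-- **`27 · ∏_{μ ∈ Γ} μ(k) = j(H_k)`**: with Mathlib's `j`-invariant of the lane's Weierstrass model
`W_k = ⟨−k, −k², (k³−1)/3, k(k³−1)/3, −(k³−1)²/27⟩` of `H_k`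
(`HessePencilWeierstrassForm.hesse_weierstrass_j`: `j(W_k) = 27k³(k³ + 8)³/(k³ − 1)³`), the printed
`J(k) = (1/64) ∏_{μ ∈ Γ} μ(k)` reads `j = 1728 J = 27 ∏_{μ ∈ Γ} μ(k)` (`3 ≠ 0`, `k³ ≠ 1`).
[cite: BonifantMilnor2018, §3, eq. (14) and Theorem 3.12 (2)] -/
theorem hesse_tetrahedral_prod_eq_j (h3 : (3 : K) ≠ 0) {ω : K} (hω : ω ^ 2 + ω + 1 = 0) {k : K}
    (hk : k ^ 3 ≠ 1) :
    haveI := (hesse_weierstrass_isElliptic_iff h3 k).2 hk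
    27 * ((∏ a : Fin 3, ω ^ (a : ℕ) * k) *
        ∏ a : Fin 3, ∏ b : Fin 3, ω ^ (a : ℕ) * ((k + 2 * ω ^ (b : ℕ)) / (k - ω ^ (b : ℕ)))) =
      ({ a₁ := -k
         a₂ := -k ^ 2
         a₃ := (k ^ 3 - 1) / 3
         a₄ := k * (k ^ 3 - 1) / 3
         a₆ := -(k ^ 3 - 1) ^ 2 / 27 } : WeierstrassCurve K).j := by
  rw [hesse_tetrahedral_prod hω hk, hesse_weierstrass_j h3 hk]
  ring

/-! ## §5 The group `Γ = ⟨η, ρ⟩`: the tetrahedral relations and Milnor's example -/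

/-- **"Clearly `η : 1 ↔ ∞` under the involution `η`, and it is not hard to check that
`η : γ ↔ γ̄`"** — `η` permutes the four cusps `{1, γ, γ̄, ∞}` (the singular members) as the
double transposition `(1 ∞)(γ γ̄)`: on the affine cusps `η(ω) = ω²`, `η(ω²) = ω` (`3 ≠ 0`), and
in homogeneous coordinates `N_η = [[1, 2], [1, −1]]` sends `(1 : 1) ↦ (3 : 0) = ∞` and
`∞ = (1 : 0) ↦ (1 : 1)`. [cite: BonifantMilnor2018, §3, Theorem 3.12 (proof)] -/
theorem moebius_eta_cusps (h3 : (3 : K) ≠ 0) {ω : K} (hω : ω ^ 2 + ω + 1 = 0) :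
    (ω + 2) / (ω - 1) = ω ^ 2 ∧ (ω ^ 2 + 2) / (ω ^ 2 - 1) = ω ∧
      (!![(1 : K), 2; 1, -1] *ᵥ ![1, 1] = ![3, 0]) ∧ (!![(1 : K), 2; 1, -1] *ᵥ ![1, 0] = ![1, 1]) := by
  have hω1 : ω - 1 ≠ 0 := by
    intro h
    have hω' : ω = 1 := sub_eq_zero.1 h
    apply h3
    linear_combination hω - (ω + 2) * hω'
  have hω2 : ω ^ 2 - 1 ≠ 0 := by
    rw [show ω ^ 2 - 1 = (ω - 1) * (ω + 1) by ring]
    refine mul_ne_zero hω1 ?_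
    intro h
    have hω' : ω = -1 := by linear_combination h
    rw [hω'] at hω
    norm_num at hω
  refine ⟨?_, ?_, ?_, ?_⟩
  · rw [div_eq_iff hω1]
    linear_combination (2 - ω) * hω
  · rw [div_eq_iff hω2]
    linear_combination (2 - ω) * hω
  · ext i
    fin_cases i <;> norm_num [Matrix.mulVec, dotProduct]
  · ext i
    fin_cases i <;> simp [Matrix.mulVec, dotProduct]

/-- **The tetrahedral relations `η² = 1`, `ρ³ = 1`, `(ηρ)³ = 1`** ("`Γ` is equal to the twelve
element tetrahedral group", `A₄ = ⟨η, ρ | η², ρ³, (ηρ)³⟩`): in homogeneous coordinates with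
`N_η = [[1, 2], [1, −1]]`, `N_ρ = diag(ω, 1)`: `N_η² = 3·1`, `N_ρ³ = 1`, and
`(N_η N_ρ)³ = −3(2ω + 1)·1` with `(2ω + 1)² = −3` — scalar matrices, i.e. the identity of `ℙ¹`
(non-zero scalars when `3 ≠ 0`). [cite: BonifantMilnor2018, §3, Theorem 3.12]
[cite: ArtebaniDolgachev2009, §4 ("generators of `A₄` of orders `2` and `3`")] -/
theorem moebius_eta_rho_pow_three {ω : K} (hω : ω ^ 2 + ω + 1 = 0) :
    (!![(1 : K), 2; 1, -1]) ^ 2 = (3 : K) • (1 : Matrix (Fin 2) (Fin 2) K) ∧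
      (!![ω, 0; 0, (1 : K)]) ^ 3 = 1 ∧
      (!![(1 : K), 2; 1, -1] * !![ω, 0; 0, (1 : K)]) ^ 3 =
        (-3 * (2 * ω + 1)) • (1 : Matrix (Fin 2) (Fin 2) K) ∧
      (2 * ω + 1) ^ 2 = (-3 : K) := by
  have hω3 := omega_pow_three' hω
  refine ⟨?_, ?_, ?_, by linear_combination 4 * hω⟩
  · ext i j
    fin_cases i <;> fin_cases j <;> norm_num [pow_two, Matrix.mul_apply, Fin.sum_univ_two]
  · ext i j
    fin_cases i <;> fin_cases j <;> simp [pow_succ, Matrix.mul_apply, Fin.sum_univ_two]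
    linear_combination (ω - 1) * hω
  · ext i j
    fin_cases i <;> fin_cases j <;>
      simp [pow_succ, Matrix.mul_apply, Fin.sum_univ_two, Matrix.smul_apply]
    · linear_combination (ω + 3) * hω
    · linear_combination 2 * hω
    · linear_combination ω * hω
    · linear_combination 2 * hω

/-- **Milnor's example: `J(1 + √3) = 1`** — the harmonic member: for `s² = 3` (`3 ≠ 0`),
`𝐣[1 + s] = 64` (`= 64·J`; equivalently `j = 1728`). [cite: BonifantMilnor2018, §3, after eq. (14)
("`k = 1 ± √3` yields `J = 1`") and Theorem 3.12 (proof)] -/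
theorem hesseJ_one_add_sqrt_three (h3 : (3 : K) ≠ 0) {s : K} (hs : s ^ 2 = 3) :
    𝐣[1 + s] = 64 := by
  have e3 : (1 + s) ^ 3 = 10 + 6 * s := by linear_combination (s + 3) * hs
  have h32 : 3 + 2 * s ≠ 0 := by
    intro h
    apply h3
    linear_combination (2 * s - 3) * h - 4 * hs
  have hden : (1 + s) ^ 3 - 1 ≠ 0 := by
    rw [e3, show (10 + 6 * s - 1 : K) = 3 * (3 + 2 * s) by ring]
    exact mul_ne_zero h3 h32
  rw [div_eq_iff (pow_ne_zero _ hden), e3]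
  linear_combination (1296 * s ^ 2 - 3888) * hs

/-- **"`1 + √3` is a fixed point of `η`" and footnote 10: "`ρ⁻¹ ∘ η ∘ ρ(1 + √3) = 1 − √3`"**
(`s² = 3`, `3 ≠ 0`, `ω² + ω + 1 = 0`; `ρ⁻¹ = ρ²` is multiplication by `ω²`): Milnor's six-point
orbit `{(1 ± √3)γ^a}` of the harmonic member. [cite: BonifantMilnor2018, §3, Theorem 3.12
(proof and footnote 10)] -/
theorem moebius_eta_one_add_sqrt_three (h3 : (3 : K) ≠ 0) {ω : K} (hω : ω ^ 2 + ω + 1 = 0) {s : K}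
    (hs : s ^ 2 = 3) :
    (1 + s + 2) / (1 + s - 1) = 1 + s ∧
      ω ^ 2 * ((ω * (1 + s) + 2) / (ω * (1 + s) - 1)) = 1 - s := by
  have hs0 : s ≠ 0 := by
    intro h
    apply h3
    rw [← hs, h]
    ring
  have e3 : (1 + s) ^ 3 = 10 + 6 * s := by linear_combination (s + 3) * hs
  have h32 : 3 + 2 * s ≠ 0 := by
    intro h
    apply h3
    linear_combination (2 * s - 3) * h - 4 * hs
  have hk : (1 + s) ^ 3 ≠ 1 := by
    rw [e3]
    intro h
    apply mul_ne_zero h3 h32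
    linear_combination h
  have hden : ω * (1 + s) - 1 ≠ 0 := by
    have := omega_pow_mul_ne_one hω hk 1
    rw [pow_one] at this
    exact sub_ne_zero.2 this
  refine ⟨?_, ?_⟩
  · rw [show (1 + s - 1 : K) = s by ring, div_eq_iff hs0]
    linear_combination -hs
  · rw [mul_div_assoc', div_eq_iff hden]
    linear_combination ((1 + s) * (ω - 1) + 2) * hω + ω * hs

end TetrahedralOrbits

end Literature.AlgebraicGeometry.PlaneCurves
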